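import Mathlib.Analysis.SpecialFunctions.Trigonometric.Basic
import HarnessLib

/-!
# THE GLUING STEP AT TWO LATTICE SPACINGS — (Γ15b) THE LIVE-`U` KNIT AT THE COVER, TWO GRIDS, III: THE SMALLNESS OF 53's DEFECT LETTER (dag-n15-c g15, FILE 123b; N15 = NE2,
# s1 «background-layer OPERATOR ingredient»)

Cell `pub-ymgap`, seat `pub-ymgap-dag-n15-c` (R134 (a); HUMAN RULING D-0062), generation 15.  `bears_on: R4∕N15 · K3⁸ SpineGivenEndpointR13SepCoPHV (stmt-QuantumFields-27366)`.
Filed `--kind proof --supports stmt-QuantumFields-27366 --as helper` — COUNT-NEUTRAL.  Pure real arithmetic; 0 `def`, 0 `sorry`; imports only `Mathlib` ∕ `HarnessLib` (FILE 119 `cvSmall`'s proof is re-run for ★ `cvSmallHalf`, not imported).  Nothing in the tree is modified.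

WHAT.  dag-n15-w3 file 53 `CurvedSpecies.uN_hasMaj_idef_glueInv_smoothCutDressed_localGauges` bounds the η-defect of the glued propagator by an explicit letter `K(…)·e^{−(ρ₃−2σ)d}`, where
`K` — displayed VERBATIM below as the left-hand side — is a polynomial in the one-grid letters (`N_ov, |ι|², |J|, β, β₁, c_t, R, c_r, c₁, c₂, θ_W, c_N, ℓ, ε, ω, d₁, θ_F, ε₀`, the glue
factors `(1 − q)⁻¹`, `(1 − E)⁻¹`) that is HOMOGENEOUS OF DEGREE ONE in the two-grid letters (`m₀, m₁, o_χ, o_χ₁, o_χ₂, o, o₁, o₂, r_W, r_N, o_o, r_F, r_D, o_W, c₁η, c₁η′`).  ★★ `cvSmall53`: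
if every two-grid letter is `≤ κ·S` and every one-grid letter is bounded (`(1 − q)⁻¹, (1 − E)⁻¹ ≤ 2`, the `w`-dependent letters by `w`-free ones), then `0 ≤ K ≤ D·S` with `D` the SAME
polynomial in the bounds — a monotone evaluation certificate (every coefficient of `K` is nonnegative), node by node (`cvkCadd`, `cvkCmul`, `cvkSadd`, `cvkCSmul`, `cvkSCmul`).  FILE 123
instantiates it at the cover (`S = (L^k)^{−1∕16} + o + o_W + r_D`).

HONEST FRAMING ∕ LIMITS.  Real arithmetic only; no analytic content; nothing of [B5]∕[B6]∕[B9] asserted.  NE2⁺ NOT PRINTED, NOT proved; N15 NOT discharged; K3⁸ OPEN, skeleton v6 untouched;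
counts of record UNMOVED (typed 28∕28 · discharged 5∕27); one finite 𝕋⁴ at fixed ε — NOT infinite volume, NOT OS on ℝ⁴, NOT a mass gap, NOT Clay.
-/

noncomputable section

namespace Summit.QuantumFields.YangMills.BalabanUVNodes.N15.Gluing

open Real

/-! ## §1 The nodes of the monotone evaluation certificate -/

/-- sum of two bounded nonnegative terms. [folklore] -/
theorem cvkCadd {a b A B : ℝ} (ha : 0 ≤ a ∧ a ≤ A) (hb : 0 ≤ b ∧ b ≤ B) : 0 ≤ a + b ∧ a + b ≤ A + B := ⟨add_nonneg ha.1 hb.1, add_le_add ha.2 hb.2⟩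

/-- product of two bounded nonnegative terms. [folklore] -/
theorem cvkCmul {a b A B : ℝ} (ha : 0 ≤ a ∧ a ≤ A) (hb : 0 ≤ b ∧ b ≤ B) : 0 ≤ a * b ∧ a * b ≤ A * B := ⟨mul_nonneg ha.1 hb.1, mul_le_mul ha.2 hb.2 hb.1 (ha.1.trans ha.2)⟩

/-- sum of two terms of size `S`. [folklore] -/
theorem cvkSadd {a b A B S : ℝ} (ha : 0 ≤ a ∧ a ≤ A * S) (hb : 0 ≤ b ∧ b ≤ B * S) : 0 ≤ a + b ∧ a + b ≤ (A + B) * S :=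
  ⟨add_nonneg ha.1 hb.1, by rw [add_mul]; exact add_le_add ha.2 hb.2⟩

/-- a term of size `S` plus zero. [folklore] -/
theorem cvkSadd0 {a A S : ℝ} (ha : 0 ≤ a ∧ a ≤ A * S) : 0 ≤ a + 0 ∧ a + 0 ≤ A * S := by rw [add_zero]; exact ha

/-- zero plus a term of size `S`. [folklore] -/
theorem cvk0Sadd {a A S : ℝ} (ha : 0 ≤ a ∧ a ≤ A * S) : 0 ≤ 0 + a ∧ 0 + a ≤ A * S := by rw [zero_add]; exact ha

/-- a bounded term times a term of size `S`. [folklore] -/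
theorem cvkCSmul {a b A B S : ℝ} (ha : 0 ≤ a ∧ a ≤ A) (hb : 0 ≤ b ∧ b ≤ B * S) : 0 ≤ a * b ∧ a * b ≤ (A * B) * S :=
  ⟨mul_nonneg ha.1 hb.1, by rw [mul_assoc]; exact mul_le_mul ha.2 hb.2 hb.1 (ha.1.trans ha.2)⟩

/-- a term of size `S` times a bounded term. [folklore] -/
theorem cvkSCmul {a b A B S : ℝ} (ha : 0 ≤ a ∧ a ≤ A * S) (hb : 0 ≤ b ∧ b ≤ B) : 0 ≤ a * b ∧ a * b ≤ (A * B) * S :=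
  ⟨mul_nonneg ha.1 hb.1, by rw [mul_right_comm]; exact mul_le_mul ha.2 hb.2 hb.1 (ha.1.trans ha.2)⟩

/-! ## §2 The smallness of 53's defect letter -/

set_option maxHeartbeats 400000 in
/-- ★★ **THE DEFECT LETTER OF 53 IS OF SIZE `S`**: the left-hand side is dag-n15-w3 53's letter `K` VERBATIM (`cι2 = |ι|²`, `cι = |ι|`, `cJ = |J|`); if the two-grid letters are `≤ κ·S`
and the one-grid letters are bounded as displayed, then `0 ≤ K ≤ D·S`, `D` the same polynomial in the bounds (monotone evaluation: every coefficient of `K` is a product of nonnegative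
letters). [cite: Balaban1984PropagatorsII, (2.134)–(2.135) p.247 («O(M⁻¹)», shape); Balaban1985BackgroundPropagators, Thm 3.14 pp.426–427 (difference template)] -/
theorem cvSmall53 {Nov cι2 cι cJ β β₁ ct R cr c₁ c₂ θW cN ℓ ε ω d₁ θF ε₀ m₀ m₁ oχ oχ₁ oχ₂ o o₁ o₂ rW rN oo rF rD oW η η' S ctb c₁b c₂b cNb ε₀b θFb LRb km₀ km₁ koχ koχ₁ koχ₂ ko ko₁ ko₂ krW krN koo krF krD koW kη0 kη1 : ℝ}
    (h0Nov : 0 ≤ Nov) (h0cι2 : 0 ≤ cι2) (h0cι : 0 ≤ cι) (h0cJ : 0 ≤ cJ) (h0β : 0 ≤ β) (h0β₁ : 0 ≤ β₁) (h0R : 0 ≤ R) (h0cr : 0 ≤ cr) (h0θW : 0 ≤ θW) (h0ct : 0 ≤ ct) (hbct : ct ≤ ctb) (h0c₁ : 0 ≤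
    c₁) (hbc₁ : c₁ ≤ c₁b) (h0c₂ : 0 ≤ c₂) (hbc₂ : c₂ ≤ c₂b) (h0cN : 0 ≤ cN) (hbcN : cN ≤ cNb) (h0ε₀ : 0 ≤ ε₀) (hbε₀ : ε₀ ≤ ε₀b) (h0θF : 0 ≤ θF) (hbθF : θF ≤ θFb) (h0Iq : 0 ≤ (1 - (((β + (β₁
    + (ct * β))) * (R * cr)) * cr))⁻¹) (hbIq : (1 - (((β + (β₁ + (ct * β))) * (R * cr)) * cr))⁻¹ ≤ 2) (h0I1q : 0 ≤ (1 - (1 * (((β + (β₁ + (ct * β))) * (R * cr)) * cr)))⁻¹) (hbI1q : (1 - (1 *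
    (((β + (β₁ + (ct * β))) * (R * cr)) * cr)))⁻¹ ≤ 2) (h0LR : 0 ≤ ((ℓ * ((Real.exp 1) * ε)⁻¹) + (2 * (ω + (ℓ * d₁))))) (hbLR : ((ℓ * ((Real.exp 1) * ε)⁻¹) + (2 * (ω + (ℓ * d₁)))) ≤ LRb)
    (h0IE : 0 ≤ (1 - ((Nov * ((cι2 * (((((cJ * ((c₂ * ((β + (β₁ + (ct * β))) * (1 - (((β + (β₁ + (ct * β))) * (R * cr)) * cr))⁻¹)) + (2 * (c₁ * ((β + (β₁ + (ct * β))) * (1 - (((β + (β₁ + (ct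
    * β))) * (R * cr)) * cr))⁻¹))))) + θW) + ((cN * ((β + (β₁ + (ct * β))) * (1 - (((β + (β₁ + (ct * β))) * (R * cr)) * cr))⁻¹)) * cr)) + ((((((ℓ * ((Real.exp 1) * ε)⁻¹) + (2 * (ω + (ℓ *
    d₁)))) * R) * ((β + (β₁ + (ct * β))) * (1 - (((β + (β₁ + (ct * β))) * (R * cr)) * cr))⁻¹)) * cr) + (((R * c₁) * ((β + (β₁ + (ct * β))) * (1 - (((β + (β₁ + (ct * β))) * (R * cr)) *
    cr))⁻¹)) * cr))) + ((θF * (1 * ((β + (β₁ + (ct * β))) * (1 - (((β + (β₁ + (ct * β))) * (R * cr)) * cr))⁻¹))) * cr))) + (cι2 * ((ε₀ * (1 - (((β + (β₁ + (ct * β))) * (R * cr)) * cr))⁻¹) +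
    0)))) * cr))⁻¹)
    (hbIE : (1 - ((Nov * ((cι2 * (((((cJ * ((c₂ * ((β + (β₁ + (ct * β))) * (1 - (((β + (β₁ + (ct * β))) * (R * cr)) * cr))⁻¹)) + (2 * (c₁ * ((β + (β₁ + (ct * β))) * (1 -
    (((β + (β₁ + (ct * β))) * (R * cr)) * cr))⁻¹))))) + θW) + ((cN * ((β + (β₁ + (ct * β))) * (1 - (((β + (β₁ + (ct * β))) * (R * cr)) * cr))⁻¹)) * cr)) + ((((((ℓ * ((Real.exp 1) * ε)⁻¹) +
    (2 * (ω + (ℓ * d₁)))) * R) * ((β + (β₁ + (ct * β))) * (1 - (((β + (β₁ + (ct * β))) * (R * cr)) * cr))⁻¹)) * cr) + (((R * c₁) * ((β + (β₁ + (ct * β))) * (1 - (((β + (β₁ + (ct * β))) * (R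
    * cr)) * cr))⁻¹)) * cr))) + ((θF * (1 * ((β + (β₁ + (ct * β))) * (1 - (((β + (β₁ + (ct * β))) * (R * cr)) * cr))⁻¹))) * cr))) + (cι2 * ((ε₀ * (1 - (((β + (β₁ + (ct * β))) * (R * cr)) *
    cr))⁻¹) + 0)))) * cr))⁻¹ ≤ 2) (h0m₀ : 0 ≤ m₀) (hsm₀ : m₀ ≤ km₀ * S) (h0m₁ : 0 ≤ m₁) (hsm₁ : m₁ ≤ km₁ * S) (h0oχ : 0 ≤ oχ) (hsoχ : oχ ≤ koχ * S) (h0oχ₁ : 0 ≤ oχ₁) (hsoχ₁ : oχ₁ ≤ koχ₁ * S)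
    (h0oχ₂ : 0 ≤ oχ₂) (hsoχ₂ : oχ₂ ≤ koχ₂ * S) (h0o : 0 ≤ o) (hso : o ≤ ko * S) (h0o₁ : 0 ≤ o₁) (hso₁ : o₁ ≤ ko₁ * S) (h0o₂ : 0 ≤ o₂) (hso₂ : o₂ ≤ ko₂ * S) (h0rW : 0 ≤ rW) (hsrW : rW ≤ krW *
    S) (h0rN : 0 ≤ rN) (hsrN : rN ≤ krN * S) (h0oo : 0 ≤ oo) (hsoo : oo ≤ koo * S) (h0rF : 0 ≤ rF) (hsrF : rF ≤ krF * S) (h0rD : 0 ≤ rD) (hsrD : rD ≤ krD * S) (h0oW : 0 ≤ oW) (hsoW : oW ≤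
    koW * S) (h0Dη0 : 0 ≤ (c₁ / η⁻¹)) (hsDη0 : (c₁ / η⁻¹) ≤ kη0 * S) (h0Dη1 : 0 ≤ (c₁ / η'⁻¹)) (hsDη1 : (c₁ / η'⁻¹) ≤ kη1 * S) :
    0 ≤ ((((Nov * (cι2 * ((β + (β₁ + (ct * β))) * (1 - (((β + (β₁ + (ct * β))) * (R * cr)) * cr))⁻¹))) * (((1 - ((Nov * ((cι2 * (((((cJ * ((c₂ * ((β + (β₁ + (ct * β))) * (1 - (((β + (β₁ + (ct * β)))
        * (R * cr)) * cr))⁻¹)) + (2 * (c₁ * ((β + (β₁ + (ct * β))) * (1 - (((β + (β₁ + (ct * β))) * (R * cr)) * cr))⁻¹))))) + θW) + ((cN * ((β + (β₁ + (ct * β))) * (1 - (((β + (β₁ + (ct *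
        β))) * (R * cr)) * cr))⁻¹)) * cr)) + ((((((ℓ * ((Real.exp 1) * ε)⁻¹) + (2 * (ω + (ℓ * d₁)))) * R) * ((β + (β₁ + (ct * β))) * (1 - (((β + (β₁ + (ct * β))) * (R * cr)) * cr))⁻¹)) * cr)
        + (((R * c₁) * ((β + (β₁ + (ct * β))) * (1 - (((β + (β₁ + (ct * β))) * (R * cr)) * cr))⁻¹)) * cr))) + ((θF * (1 * ((β + (β₁ + (ct * β))) * (1 - (((β + (β₁ + (ct * β))) * (R * cr)) *
        cr))⁻¹))) * cr))) + (cι2 * ((ε₀ * (1 - (((β + (β₁ + (ct * β))) * (R * cr)) * cr))⁻¹) + 0)))) * cr))⁻¹ * (((1 - ((Nov * ((cι2 * (((((cJ * ((c₂ * ((β + (β₁ + (ct * β))) * (1 - (((β +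
        (β₁ + (ct * β))) * (R * cr)) * cr))⁻¹)) + (2 * (c₁ * ((β + (β₁ + (ct * β))) * (1 - (((β + (β₁ + (ct * β))) * (R * cr)) * cr))⁻¹))))) + θW) + ((cN * ((β + (β₁ + (ct * β))) * (1 - (((β
        + (β₁ + (ct * β))) * (R * cr)) * cr))⁻¹)) * cr)) + ((((((ℓ * ((Real.exp 1) * ε)⁻¹) + (2 * (ω + (ℓ * d₁)))) * R) * ((β + (β₁ + (ct * β))) * (1 - (((β + (β₁ + (ct * β))) * (R * cr)) *
        cr))⁻¹)) * cr) + (((R * c₁) * ((β + (β₁ + (ct * β))) * (1 - (((β + (β₁ + (ct * β))) * (R * cr)) * cr))⁻¹)) * cr))) + ((θF * (1 * ((β + (β₁ + (ct * β))) * (1 - (((β + (β₁ + (ct * β)))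
        * (R * cr)) * cr))⁻¹))) * cr))) + (cι2 * ((ε₀ * (1 - (((β + (β₁ + (ct * β))) * (R * cr)) * cr))⁻¹) + 0)))) * cr))⁻¹ * (Nov * ((((cι2 * (((((cJ * ((c₂ * ((β + (β₁ + (ct * β))) * (1 -
        (((β + (β₁ + (ct * β))) * (R * cr)) * cr))⁻¹)) + (2 * (c₁ * ((β + (β₁ + (ct * β))) * (1 - (((β + (β₁ + (ct * β))) * (R * cr)) * cr))⁻¹))))) + θW) + ((cN * ((β + (β₁ + (ct * β))) * (1
        - (((β + (β₁ + (ct * β))) * (R * cr)) * cr))⁻¹)) * cr)) + ((((((ℓ * ((Real.exp 1) * ε)⁻¹) + (2 * (ω + (ℓ * d₁)))) * R) * ((β + (β₁ + (ct * β))) * (1 - (((β + (β₁ + (ct * β))) * (R *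
        cr)) * cr))⁻¹)) * cr) + (((R * c₁) * ((β + (β₁ + (ct * β))) * (1 - (((β + (β₁ + (ct * β))) * (R * cr)) * cr))⁻¹)) * cr))) + ((θF * (1 * ((β + (β₁ + (ct * β))) * (1 - (((β + (β₁ + (ct
        * β))) * (R * cr)) * cr))⁻¹))) * cr))) * oo) + ((cι2 * (((((cJ * (((c₂ * ((((((m₀ + (oχ * β)) + (((m₁ + (oχ₁ * β₁)) + (ct * m₀)) + (oχ₂ * β))) * cr) + ((1 * (((m₀ + (oχ * β)) + (((m₁
        + (oχ₁ * β₁)) + (ct * m₀)) + (oχ₂ * β))) * cr)) * ((R * ((β + (β₁ + (ct * β))) * (1 - (((β + (β₁ + (ct * β))) * (R * cr)) * cr))⁻¹)) * cr))) + (((((β + (β₁ + (ct * β))) * o) * cr) *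
        ((β + (β₁ + (ct * β))) * (1 - (((β + (β₁ + (ct * β))) * (R * cr)) * cr))⁻¹)) * cr)) * (1 - (1 * (((β + (β₁ + (ct * β))) * (R * cr)) * cr)))⁻¹)) + (o₂ * ((β + (β₁ + (ct * β))) * (1 -
        (((β + (β₁ + (ct * β))) * (R * cr)) * cr))⁻¹))) + (2 * ((c₁ * ((((((m₀ + (oχ * β)) + (((m₁ + (oχ₁ * β₁)) + (ct * m₀)) + (oχ₂ * β))) * cr) + ((1 * (((m₀ + (oχ * β)) + (((m₁ + (oχ₁ *
        β₁)) + (ct * m₀)) + (oχ₂ * β))) * cr)) * ((R * ((β + (β₁ + (ct * β))) * (1 - (((β + (β₁ + (ct * β))) * (R * cr)) * cr))⁻¹)) * cr))) + (((((β + (β₁ + (ct * β))) * o) * cr) * ((β + (β₁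
        + (ct * β))) * (1 - (((β + (β₁ + (ct * β))) * (R * cr)) * cr))⁻¹)) * cr)) * (1 - (1 * (((β + (β₁ + (ct * β))) * (R * cr)) * cr)))⁻¹)) + (o₁ * ((β + (β₁ + (ct * β))) * (1 - (((β + (β₁
        + (ct * β))) * (R * cr)) * cr))⁻¹)))))) + rW) + (((cN * ((((((m₀ + (oχ * β)) + (((m₁ + (oχ₁ * β₁)) + (ct * m₀)) + (oχ₂ * β))) * cr) + ((1 * (((m₀ + (oχ * β)) + (((m₁ + (oχ₁ * β₁)) +
        (ct * m₀)) + (oχ₂ * β))) * cr)) * ((R * ((β + (β₁ + (ct * β))) * (1 - (((β + (β₁ + (ct * β))) * (R * cr)) * cr))⁻¹)) * cr))) + (((((β + (β₁ + (ct * β))) * o) * cr) * ((β + (β₁ + (ct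
        * β))) * (1 - (((β + (β₁ + (ct * β))) * (R * cr)) * cr))⁻¹)) * cr)) * (1 - (1 * (((β + (β₁ + (ct * β))) * (R * cr)) * cr)))⁻¹)) * cr) + ((rN * ((β + (β₁ + (ct * β))) * (1 - (((β +
        (β₁ + (ct * β))) * (R * cr)) * cr))⁻¹)) * cr))) + ((((((((ℓ * ((Real.exp 1) * ε)⁻¹) + (2 * (ω + (ℓ * d₁)))) * R) * ((((((m₀ + (oχ * β)) + (((m₁ + (oχ₁ * β₁)) + (ct * m₀)) + (oχ₂ *
        β))) * cr) + ((1 * (((m₀ + (oχ * β)) + (((m₁ + (oχ₁ * β₁)) + (ct * m₀)) + (oχ₂ * β))) * cr)) * ((R * ((β + (β₁ + (ct * β))) * (1 - (((β + (β₁ + (ct * β))) * (R * cr)) * cr))⁻¹)) *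
        cr))) + (((((β + (β₁ + (ct * β))) * o) * cr) * ((β + (β₁ + (ct * β))) * (1 - (((β + (β₁ + (ct * β))) * (R * cr)) * cr))⁻¹)) * cr)) * (1 - (1 * (((β + (β₁ + (ct * β))) * (R * cr)) *
        cr)))⁻¹)) + (((((ℓ * ((Real.exp 1) * ε)⁻¹) + (2 * (ω + (ℓ * d₁)))) * o) + ((2 * R) * ((oo + (c₁ / η'⁻¹)) + (c₁ / η⁻¹)))) * ((β + (β₁ + (ct * β))) * (1 - (((β + (β₁ + (ct * β))) * (R
        * cr)) * cr))⁻¹))) + (R * ((c₁ * ((((((m₀ + (oχ * β)) + (((m₁ + (oχ₁ * β₁)) + (ct * m₀)) + (oχ₂ * β))) * cr) + ((1 * (((m₀ + (oχ * β)) + (((m₁ + (oχ₁ * β₁)) + (ct * m₀)) + (oχ₂ *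
        β))) * cr)) * ((R * ((β + (β₁ + (ct * β))) * (1 - (((β + (β₁ + (ct * β))) * (R * cr)) * cr))⁻¹)) * cr))) + (((((β + (β₁ + (ct * β))) * o) * cr) * ((β + (β₁ + (ct * β))) * (1 - (((β +
        (β₁ + (ct * β))) * (R * cr)) * cr))⁻¹)) * cr)) * (1 - (1 * (((β + (β₁ + (ct * β))) * (R * cr)) * cr)))⁻¹)) + (o₁ * ((β + (β₁ + (ct * β))) * (1 - (((β + (β₁ + (ct * β))) * (R * cr)) *
        cr))⁻¹))))) + ((o * c₁) * ((β + (β₁ + (ct * β))) * (1 - (((β + (β₁ + (ct * β))) * (R * cr)) * cr))⁻¹))) * cr)) + (((θF * ((1 * ((((((m₀ + (oχ * β)) + (((m₁ + (oχ₁ * β₁)) + (ct * m₀))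
        + (oχ₂ * β))) * cr) + ((1 * (((m₀ + (oχ * β)) + (((m₁ + (oχ₁ * β₁)) + (ct * m₀)) + (oχ₂ * β))) * cr)) * ((R * ((β + (β₁ + (ct * β))) * (1 - (((β + (β₁ + (ct * β))) * (R * cr)) *
        cr))⁻¹)) * cr))) + (((((β + (β₁ + (ct * β))) * o) * cr) * ((β + (β₁ + (ct * β))) * (1 - (((β + (β₁ + (ct * β))) * (R * cr)) * cr))⁻¹)) * cr)) * (1 - (1 * (((β + (β₁ + (ct * β))) * (R
        * cr)) * cr)))⁻¹)) + ((1 * ((β + (β₁ + (ct * β))) * (1 - (((β + (β₁ + (ct * β))) * (R * cr)) * cr))⁻¹)) * oo))) * cr) + ((rD * (1 * ((β + (β₁ + (ct * β))) * (1 - (((β + (β₁ + (ct *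
        β))) * (R * cr)) * cr))⁻¹))) * cr)))) + (((2 * cι) * oW) * (((((cJ * ((c₂ * ((β + (β₁ + (ct * β))) * (1 - (((β + (β₁ + (ct * β))) * (R * cr)) * cr))⁻¹)) + (2 * (c₁ * ((β + (β₁ + (ct
        * β))) * (1 - (((β + (β₁ + (ct * β))) * (R * cr)) * cr))⁻¹))))) + θW) + ((cN * ((β + (β₁ + (ct * β))) * (1 - (((β + (β₁ + (ct * β))) * (R * cr)) * cr))⁻¹)) * cr)) + ((((((ℓ *
        ((Real.exp 1) * ε)⁻¹) + (2 * (ω + (ℓ * d₁)))) * R) * ((β + (β₁ + (ct * β))) * (1 - (((β + (β₁ + (ct * β))) * (R * cr)) * cr))⁻¹)) * cr) + (((R * c₁) * ((β + (β₁ + (ct * β))) * (1 -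
        (((β + (β₁ + (ct * β))) * (R * cr)) * cr))⁻¹)) * cr))) + ((θF * (1 * ((β + (β₁ + (ct * β))) * (1 - (((β + (β₁ + (ct * β))) * (R * cr)) * cr))⁻¹))) * cr))))) + (((cι2 * ((ε₀ * (1 -
        (((β + (β₁ + (ct * β))) * (R * cr)) * cr))⁻¹) + 0)) * oo) + ((cι2 * (((((ε₀ * ((R * ((((((m₀ + (oχ * β)) + (((m₁ + (oχ₁ * β₁)) + (ct * m₀)) + (oχ₂ * β))) * cr) + ((1 * (((m₀ + (oχ *
        β)) + (((m₁ + (oχ₁ * β₁)) + (ct * m₀)) + (oχ₂ * β))) * cr)) * ((R * ((β + (β₁ + (ct * β))) * (1 - (((β + (β₁ + (ct * β))) * (R * cr)) * cr))⁻¹)) * cr))) + (((((β + (β₁ + (ct * β))) *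
        o) * cr) * ((β + (β₁ + (ct * β))) * (1 - (((β + (β₁ + (ct * β))) * (R * cr)) * cr))⁻¹)) * cr)) * (1 - (1 * (((β + (β₁ + (ct * β))) * (R * cr)) * cr)))⁻¹)) + (o * ((β + (β₁ + (ct *
        β))) * (1 - (((β + (β₁ + (ct * β))) * (R * cr)) * cr))⁻¹)))) * cr) * cr) + (rF * (1 + (((R * ((β + (β₁ + (ct * β))) * (1 - (((β + (β₁ + (ct * β))) * (R * cr)) * cr))⁻¹)) * cr) *
        cr)))) + 0)) + (((2 * cι) * oW) * ((ε₀ * (1 - (((β + (β₁ + (ct * β))) * (R * cr)) * cr))⁻¹) + 0))))))) * cr)) * cr)) * cr) + (((Nov * (((2 * (cι2 * ((β + (β₁ + (ct * β))) * (1 - (((β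
        + (β₁ + (ct * β))) * (R * cr)) * cr))⁻¹))) * oo) + ((cι2 * ((((((m₀ + (oχ * β)) + (((m₁ + (oχ₁ * β₁)) + (ct * m₀)) + (oχ₂ * β))) * cr) + ((1 * (((m₀ + (oχ * β)) + (((m₁ + (oχ₁ * β₁))
        + (ct * m₀)) + (oχ₂ * β))) * cr)) * ((R * ((β + (β₁ + (ct * β))) * (1 - (((β + (β₁ + (ct * β))) * (R * cr)) * cr))⁻¹)) * cr))) + (((((β + (β₁ + (ct * β))) * o) * cr) * ((β + (β₁ +
        (ct * β))) * (1 - (((β + (β₁ + (ct * β))) * (R * cr)) * cr))⁻¹)) * cr)) * (1 - (1 * (((β + (β₁ + (ct * β))) * (R * cr)) * cr)))⁻¹)) + (((2 * cι) * oW) * ((β + (β₁ + (ct * β))) * (1 -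
        (((β + (β₁ + (ct * β))) * (R * cr)) * cr))⁻¹))))) * (1 - ((Nov * ((cι2 * (((((cJ * ((c₂ * ((β + (β₁ + (ct * β))) * (1 - (((β + (β₁ + (ct * β))) * (R * cr)) * cr))⁻¹)) + (2 * (c₁ *
        ((β + (β₁ + (ct * β))) * (1 - (((β + (β₁ + (ct * β))) * (R * cr)) * cr))⁻¹))))) + θW) + ((cN * ((β + (β₁ + (ct * β))) * (1 - (((β + (β₁ + (ct * β))) * (R * cr)) * cr))⁻¹)) * cr)) +
        ((((((ℓ * ((Real.exp 1) * ε)⁻¹) + (2 * (ω + (ℓ * d₁)))) * R) * ((β + (β₁ + (ct * β))) * (1 - (((β + (β₁ + (ct * β))) * (R * cr)) * cr))⁻¹)) * cr) + (((R * c₁) * ((β + (β₁ + (ct *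
        β))) * (1 - (((β + (β₁ + (ct * β))) * (R * cr)) * cr))⁻¹)) * cr))) + ((θF * (1 * ((β + (β₁ + (ct * β))) * (1 - (((β + (β₁ + (ct * β))) * (R * cr)) * cr))⁻¹))) * cr))) + (cι2 * ((ε₀ *
        (1 - (((β + (β₁ + (ct * β))) * (R * cr)) * cr))⁻¹) + 0)))) * cr))⁻¹) * cr)) ∧
      ((((Nov * (cι2 * ((β + (β₁ + (ct * β))) * (1 - (((β + (β₁ + (ct * β))) * (R * cr)) * cr))⁻¹))) * (((1 - ((Nov * ((cι2 * (((((cJ * ((c₂ * ((β + (β₁ + (ct * β))) * (1 - (((β + (β₁ + (ct * β)))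
        * (R * cr)) * cr))⁻¹)) + (2 * (c₁ * ((β + (β₁ + (ct * β))) * (1 - (((β + (β₁ + (ct * β))) * (R * cr)) * cr))⁻¹))))) + θW) + ((cN * ((β + (β₁ + (ct * β))) * (1 - (((β + (β₁ + (ct *
        β))) * (R * cr)) * cr))⁻¹)) * cr)) + ((((((ℓ * ((Real.exp 1) * ε)⁻¹) + (2 * (ω + (ℓ * d₁)))) * R) * ((β + (β₁ + (ct * β))) * (1 - (((β + (β₁ + (ct * β))) * (R * cr)) * cr))⁻¹)) * cr)
        + (((R * c₁) * ((β + (β₁ + (ct * β))) * (1 - (((β + (β₁ + (ct * β))) * (R * cr)) * cr))⁻¹)) * cr))) + ((θF * (1 * ((β + (β₁ + (ct * β))) * (1 - (((β + (β₁ + (ct * β))) * (R * cr)) *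
        cr))⁻¹))) * cr))) + (cι2 * ((ε₀ * (1 - (((β + (β₁ + (ct * β))) * (R * cr)) * cr))⁻¹) + 0)))) * cr))⁻¹ * (((1 - ((Nov * ((cι2 * (((((cJ * ((c₂ * ((β + (β₁ + (ct * β))) * (1 - (((β +
        (β₁ + (ct * β))) * (R * cr)) * cr))⁻¹)) + (2 * (c₁ * ((β + (β₁ + (ct * β))) * (1 - (((β + (β₁ + (ct * β))) * (R * cr)) * cr))⁻¹))))) + θW) + ((cN * ((β + (β₁ + (ct * β))) * (1 - (((β
        + (β₁ + (ct * β))) * (R * cr)) * cr))⁻¹)) * cr)) + ((((((ℓ * ((Real.exp 1) * ε)⁻¹) + (2 * (ω + (ℓ * d₁)))) * R) * ((β + (β₁ + (ct * β))) * (1 - (((β + (β₁ + (ct * β))) * (R * cr)) *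
        cr))⁻¹)) * cr) + (((R * c₁) * ((β + (β₁ + (ct * β))) * (1 - (((β + (β₁ + (ct * β))) * (R * cr)) * cr))⁻¹)) * cr))) + ((θF * (1 * ((β + (β₁ + (ct * β))) * (1 - (((β + (β₁ + (ct * β)))
        * (R * cr)) * cr))⁻¹))) * cr))) + (cι2 * ((ε₀ * (1 - (((β + (β₁ + (ct * β))) * (R * cr)) * cr))⁻¹) + 0)))) * cr))⁻¹ * (Nov * ((((cι2 * (((((cJ * ((c₂ * ((β + (β₁ + (ct * β))) * (1 -
        (((β + (β₁ + (ct * β))) * (R * cr)) * cr))⁻¹)) + (2 * (c₁ * ((β + (β₁ + (ct * β))) * (1 - (((β + (β₁ + (ct * β))) * (R * cr)) * cr))⁻¹))))) + θW) + ((cN * ((β + (β₁ + (ct * β))) * (1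
        - (((β + (β₁ + (ct * β))) * (R * cr)) * cr))⁻¹)) * cr)) + ((((((ℓ * ((Real.exp 1) * ε)⁻¹) + (2 * (ω + (ℓ * d₁)))) * R) * ((β + (β₁ + (ct * β))) * (1 - (((β + (β₁ + (ct * β))) * (R *
        cr)) * cr))⁻¹)) * cr) + (((R * c₁) * ((β + (β₁ + (ct * β))) * (1 - (((β + (β₁ + (ct * β))) * (R * cr)) * cr))⁻¹)) * cr))) + ((θF * (1 * ((β + (β₁ + (ct * β))) * (1 - (((β + (β₁ + (ct
        * β))) * (R * cr)) * cr))⁻¹))) * cr))) * oo) + ((cι2 * (((((cJ * (((c₂ * ((((((m₀ + (oχ * β)) + (((m₁ + (oχ₁ * β₁)) + (ct * m₀)) + (oχ₂ * β))) * cr) + ((1 * (((m₀ + (oχ * β)) + (((m₁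
        + (oχ₁ * β₁)) + (ct * m₀)) + (oχ₂ * β))) * cr)) * ((R * ((β + (β₁ + (ct * β))) * (1 - (((β + (β₁ + (ct * β))) * (R * cr)) * cr))⁻¹)) * cr))) + (((((β + (β₁ + (ct * β))) * o) * cr) *
        ((β + (β₁ + (ct * β))) * (1 - (((β + (β₁ + (ct * β))) * (R * cr)) * cr))⁻¹)) * cr)) * (1 - (1 * (((β + (β₁ + (ct * β))) * (R * cr)) * cr)))⁻¹)) + (o₂ * ((β + (β₁ + (ct * β))) * (1 -
        (((β + (β₁ + (ct * β))) * (R * cr)) * cr))⁻¹))) + (2 * ((c₁ * ((((((m₀ + (oχ * β)) + (((m₁ + (oχ₁ * β₁)) + (ct * m₀)) + (oχ₂ * β))) * cr) + ((1 * (((m₀ + (oχ * β)) + (((m₁ + (oχ₁ *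
        β₁)) + (ct * m₀)) + (oχ₂ * β))) * cr)) * ((R * ((β + (β₁ + (ct * β))) * (1 - (((β + (β₁ + (ct * β))) * (R * cr)) * cr))⁻¹)) * cr))) + (((((β + (β₁ + (ct * β))) * o) * cr) * ((β + (β₁
        + (ct * β))) * (1 - (((β + (β₁ + (ct * β))) * (R * cr)) * cr))⁻¹)) * cr)) * (1 - (1 * (((β + (β₁ + (ct * β))) * (R * cr)) * cr)))⁻¹)) + (o₁ * ((β + (β₁ + (ct * β))) * (1 - (((β + (β₁
        + (ct * β))) * (R * cr)) * cr))⁻¹)))))) + rW) + (((cN * ((((((m₀ + (oχ * β)) + (((m₁ + (oχ₁ * β₁)) + (ct * m₀)) + (oχ₂ * β))) * cr) + ((1 * (((m₀ + (oχ * β)) + (((m₁ + (oχ₁ * β₁)) +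
        (ct * m₀)) + (oχ₂ * β))) * cr)) * ((R * ((β + (β₁ + (ct * β))) * (1 - (((β + (β₁ + (ct * β))) * (R * cr)) * cr))⁻¹)) * cr))) + (((((β + (β₁ + (ct * β))) * o) * cr) * ((β + (β₁ + (ct
        * β))) * (1 - (((β + (β₁ + (ct * β))) * (R * cr)) * cr))⁻¹)) * cr)) * (1 - (1 * (((β + (β₁ + (ct * β))) * (R * cr)) * cr)))⁻¹)) * cr) + ((rN * ((β + (β₁ + (ct * β))) * (1 - (((β +
        (β₁ + (ct * β))) * (R * cr)) * cr))⁻¹)) * cr))) + ((((((((ℓ * ((Real.exp 1) * ε)⁻¹) + (2 * (ω + (ℓ * d₁)))) * R) * ((((((m₀ + (oχ * β)) + (((m₁ + (oχ₁ * β₁)) + (ct * m₀)) + (oχ₂ *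
        β))) * cr) + ((1 * (((m₀ + (oχ * β)) + (((m₁ + (oχ₁ * β₁)) + (ct * m₀)) + (oχ₂ * β))) * cr)) * ((R * ((β + (β₁ + (ct * β))) * (1 - (((β + (β₁ + (ct * β))) * (R * cr)) * cr))⁻¹)) *
        cr))) + (((((β + (β₁ + (ct * β))) * o) * cr) * ((β + (β₁ + (ct * β))) * (1 - (((β + (β₁ + (ct * β))) * (R * cr)) * cr))⁻¹)) * cr)) * (1 - (1 * (((β + (β₁ + (ct * β))) * (R * cr)) *
        cr)))⁻¹)) + (((((ℓ * ((Real.exp 1) * ε)⁻¹) + (2 * (ω + (ℓ * d₁)))) * o) + ((2 * R) * ((oo + (c₁ / η'⁻¹)) + (c₁ / η⁻¹)))) * ((β + (β₁ + (ct * β))) * (1 - (((β + (β₁ + (ct * β))) * (R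
        * cr)) * cr))⁻¹))) + (R * ((c₁ * ((((((m₀ + (oχ * β)) + (((m₁ + (oχ₁ * β₁)) + (ct * m₀)) + (oχ₂ * β))) * cr) + ((1 * (((m₀ + (oχ * β)) + (((m₁ + (oχ₁ * β₁)) + (ct * m₀)) + (oχ₂ *
        β))) * cr)) * ((R * ((β + (β₁ + (ct * β))) * (1 - (((β + (β₁ + (ct * β))) * (R * cr)) * cr))⁻¹)) * cr))) + (((((β + (β₁ + (ct * β))) * o) * cr) * ((β + (β₁ + (ct * β))) * (1 - (((β +
        (β₁ + (ct * β))) * (R * cr)) * cr))⁻¹)) * cr)) * (1 - (1 * (((β + (β₁ + (ct * β))) * (R * cr)) * cr)))⁻¹)) + (o₁ * ((β + (β₁ + (ct * β))) * (1 - (((β + (β₁ + (ct * β))) * (R * cr)) *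
        cr))⁻¹))))) + ((o * c₁) * ((β + (β₁ + (ct * β))) * (1 - (((β + (β₁ + (ct * β))) * (R * cr)) * cr))⁻¹))) * cr)) + (((θF * ((1 * ((((((m₀ + (oχ * β)) + (((m₁ + (oχ₁ * β₁)) + (ct * m₀))
        + (oχ₂ * β))) * cr) + ((1 * (((m₀ + (oχ * β)) + (((m₁ + (oχ₁ * β₁)) + (ct * m₀)) + (oχ₂ * β))) * cr)) * ((R * ((β + (β₁ + (ct * β))) * (1 - (((β + (β₁ + (ct * β))) * (R * cr)) *
        cr))⁻¹)) * cr))) + (((((β + (β₁ + (ct * β))) * o) * cr) * ((β + (β₁ + (ct * β))) * (1 - (((β + (β₁ + (ct * β))) * (R * cr)) * cr))⁻¹)) * cr)) * (1 - (1 * (((β + (β₁ + (ct * β))) * (R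
        * cr)) * cr)))⁻¹)) + ((1 * ((β + (β₁ + (ct * β))) * (1 - (((β + (β₁ + (ct * β))) * (R * cr)) * cr))⁻¹)) * oo))) * cr) + ((rD * (1 * ((β + (β₁ + (ct * β))) * (1 - (((β + (β₁ + (ct *
        β))) * (R * cr)) * cr))⁻¹))) * cr)))) + (((2 * cι) * oW) * (((((cJ * ((c₂ * ((β + (β₁ + (ct * β))) * (1 - (((β + (β₁ + (ct * β))) * (R * cr)) * cr))⁻¹)) + (2 * (c₁ * ((β + (β₁ + (ct
        * β))) * (1 - (((β + (β₁ + (ct * β))) * (R * cr)) * cr))⁻¹))))) + θW) + ((cN * ((β + (β₁ + (ct * β))) * (1 - (((β + (β₁ + (ct * β))) * (R * cr)) * cr))⁻¹)) * cr)) + ((((((ℓ *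
        ((Real.exp 1) * ε)⁻¹) + (2 * (ω + (ℓ * d₁)))) * R) * ((β + (β₁ + (ct * β))) * (1 - (((β + (β₁ + (ct * β))) * (R * cr)) * cr))⁻¹)) * cr) + (((R * c₁) * ((β + (β₁ + (ct * β))) * (1 -
        (((β + (β₁ + (ct * β))) * (R * cr)) * cr))⁻¹)) * cr))) + ((θF * (1 * ((β + (β₁ + (ct * β))) * (1 - (((β + (β₁ + (ct * β))) * (R * cr)) * cr))⁻¹))) * cr))))) + (((cι2 * ((ε₀ * (1 -
        (((β + (β₁ + (ct * β))) * (R * cr)) * cr))⁻¹) + 0)) * oo) + ((cι2 * (((((ε₀ * ((R * ((((((m₀ + (oχ * β)) + (((m₁ + (oχ₁ * β₁)) + (ct * m₀)) + (oχ₂ * β))) * cr) + ((1 * (((m₀ + (oχ *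
        β)) + (((m₁ + (oχ₁ * β₁)) + (ct * m₀)) + (oχ₂ * β))) * cr)) * ((R * ((β + (β₁ + (ct * β))) * (1 - (((β + (β₁ + (ct * β))) * (R * cr)) * cr))⁻¹)) * cr))) + (((((β + (β₁ + (ct * β))) *
        o) * cr) * ((β + (β₁ + (ct * β))) * (1 - (((β + (β₁ + (ct * β))) * (R * cr)) * cr))⁻¹)) * cr)) * (1 - (1 * (((β + (β₁ + (ct * β))) * (R * cr)) * cr)))⁻¹)) + (o * ((β + (β₁ + (ct *
        β))) * (1 - (((β + (β₁ + (ct * β))) * (R * cr)) * cr))⁻¹)))) * cr) * cr) + (rF * (1 + (((R * ((β + (β₁ + (ct * β))) * (1 - (((β + (β₁ + (ct * β))) * (R * cr)) * cr))⁻¹)) * cr) *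
        cr)))) + 0)) + (((2 * cι) * oW) * ((ε₀ * (1 - (((β + (β₁ + (ct * β))) * (R * cr)) * cr))⁻¹) + 0))))))) * cr)) * cr)) * cr) + (((Nov * (((2 * (cι2 * ((β + (β₁ + (ct * β))) * (1 - (((β
        + (β₁ + (ct * β))) * (R * cr)) * cr))⁻¹))) * oo) + ((cι2 * ((((((m₀ + (oχ * β)) + (((m₁ + (oχ₁ * β₁)) + (ct * m₀)) + (oχ₂ * β))) * cr) + ((1 * (((m₀ + (oχ * β)) + (((m₁ + (oχ₁ * β₁))
        + (ct * m₀)) + (oχ₂ * β))) * cr)) * ((R * ((β + (β₁ + (ct * β))) * (1 - (((β + (β₁ + (ct * β))) * (R * cr)) * cr))⁻¹)) * cr))) + (((((β + (β₁ + (ct * β))) * o) * cr) * ((β + (β₁ +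
        (ct * β))) * (1 - (((β + (β₁ + (ct * β))) * (R * cr)) * cr))⁻¹)) * cr)) * (1 - (1 * (((β + (β₁ + (ct * β))) * (R * cr)) * cr)))⁻¹)) + (((2 * cι) * oW) * ((β + (β₁ + (ct * β))) * (1 -
        (((β + (β₁ + (ct * β))) * (R * cr)) * cr))⁻¹))))) * (1 - ((Nov * ((cι2 * (((((cJ * ((c₂ * ((β + (β₁ + (ct * β))) * (1 - (((β + (β₁ + (ct * β))) * (R * cr)) * cr))⁻¹)) + (2 * (c₁ *
        ((β + (β₁ + (ct * β))) * (1 - (((β + (β₁ + (ct * β))) * (R * cr)) * cr))⁻¹))))) + θW) + ((cN * ((β + (β₁ + (ct * β))) * (1 - (((β + (β₁ + (ct * β))) * (R * cr)) * cr))⁻¹)) * cr)) +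
        ((((((ℓ * ((Real.exp 1) * ε)⁻¹) + (2 * (ω + (ℓ * d₁)))) * R) * ((β + (β₁ + (ct * β))) * (1 - (((β + (β₁ + (ct * β))) * (R * cr)) * cr))⁻¹)) * cr) + (((R * c₁) * ((β + (β₁ + (ct *
        β))) * (1 - (((β + (β₁ + (ct * β))) * (R * cr)) * cr))⁻¹)) * cr))) + ((θF * (1 * ((β + (β₁ + (ct * β))) * (1 - (((β + (β₁ + (ct * β))) * (R * cr)) * cr))⁻¹))) * cr))) + (cι2 * ((ε₀ *
        (1 - (((β + (β₁ + (ct * β))) * (R * cr)) * cr))⁻¹) + 0)))) * cr))⁻¹) * cr))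
        ≤ ((((Nov * (cι2 * ((β + (β₁ + (ctb * β))) * 2))) * ((2 * ((2 * (Nov * ((((cι2 * (((((cJ * ((c₂b * ((β + (β₁ + (ctb * β))) * 2)) + (2 * (c₁b * ((β + (β₁ + (ctb * β))) * 2))))) + θW) + ((cNb *
          ((β + (β₁ + (ctb * β))) * 2)) * cr)) + ((((LRb * R) * ((β + (β₁ + (ctb * β))) * 2)) * cr) + (((R * c₁b) * ((β + (β₁ + (ctb * β))) * 2)) * cr))) + ((θFb * (1 * ((β + (β₁ + (ctb *
          β))) * 2))) * cr))) * koo) + ((cι2 * (((((cJ * (((c₂b * ((((((km₀ + (koχ * β)) + (((km₁ + (koχ₁ * β₁)) + (ctb * km₀)) + (koχ₂ * β))) * cr) + ((1 * (((km₀ + (koχ * β)) + (((km₁ +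
          (koχ₁ * β₁)) + (ctb * km₀)) + (koχ₂ * β))) * cr)) * ((R * ((β + (β₁ + (ctb * β))) * 2)) * cr))) + (((((β + (β₁ + (ctb * β))) * ko) * cr) * ((β + (β₁ + (ctb * β))) * 2)) * cr)) *
          2)) + (ko₂ * ((β + (β₁ + (ctb * β))) * 2))) + (2 * ((c₁b * ((((((km₀ + (koχ * β)) + (((km₁ + (koχ₁ * β₁)) + (ctb * km₀)) + (koχ₂ * β))) * cr) + ((1 * (((km₀ + (koχ * β)) + (((km₁ +
          (koχ₁ * β₁)) + (ctb * km₀)) + (koχ₂ * β))) * cr)) * ((R * ((β + (β₁ + (ctb * β))) * 2)) * cr))) + (((((β + (β₁ + (ctb * β))) * ko) * cr) * ((β + (β₁ + (ctb * β))) * 2)) * cr)) *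
          2)) + (ko₁ * ((β + (β₁ + (ctb * β))) * 2)))))) + krW) + (((cNb * ((((((km₀ + (koχ * β)) + (((km₁ + (koχ₁ * β₁)) + (ctb * km₀)) + (koχ₂ * β))) * cr) + ((1 * (((km₀ + (koχ * β)) +
          (((km₁ + (koχ₁ * β₁)) + (ctb * km₀)) + (koχ₂ * β))) * cr)) * ((R * ((β + (β₁ + (ctb * β))) * 2)) * cr))) + (((((β + (β₁ + (ctb * β))) * ko) * cr) * ((β + (β₁ + (ctb * β))) * 2)) *
          cr)) * 2)) * cr) + ((krN * ((β + (β₁ + (ctb * β))) * 2)) * cr))) + ((((((LRb * R) * ((((((km₀ + (koχ * β)) + (((km₁ + (koχ₁ * β₁)) + (ctb * km₀)) + (koχ₂ * β))) * cr) + ((1 *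
          (((km₀ + (koχ * β)) + (((km₁ + (koχ₁ * β₁)) + (ctb * km₀)) + (koχ₂ * β))) * cr)) * ((R * ((β + (β₁ + (ctb * β))) * 2)) * cr))) + (((((β + (β₁ + (ctb * β))) * ko) * cr) * ((β + (β₁
          + (ctb * β))) * 2)) * cr)) * 2)) + (((LRb * ko) + ((2 * R) * ((koo + kη1) + kη0))) * ((β + (β₁ + (ctb * β))) * 2))) + (R * ((c₁b * ((((((km₀ + (koχ * β)) + (((km₁ + (koχ₁ * β₁)) +
          (ctb * km₀)) + (koχ₂ * β))) * cr) + ((1 * (((km₀ + (koχ * β)) + (((km₁ + (koχ₁ * β₁)) + (ctb * km₀)) + (koχ₂ * β))) * cr)) * ((R * ((β + (β₁ + (ctb * β))) * 2)) * cr))) + (((((β +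
          (β₁ + (ctb * β))) * ko) * cr) * ((β + (β₁ + (ctb * β))) * 2)) * cr)) * 2)) + (ko₁ * ((β + (β₁ + (ctb * β))) * 2))))) + ((ko * c₁b) * ((β + (β₁ + (ctb * β))) * 2))) * cr)) + (((θFb
          * ((1 * ((((((km₀ + (koχ * β)) + (((km₁ + (koχ₁ * β₁)) + (ctb * km₀)) + (koχ₂ * β))) * cr) + ((1 * (((km₀ + (koχ * β)) + (((km₁ + (koχ₁ * β₁)) + (ctb * km₀)) + (koχ₂ * β))) * cr))
          * ((R * ((β + (β₁ + (ctb * β))) * 2)) * cr))) + (((((β + (β₁ + (ctb * β))) * ko) * cr) * ((β + (β₁ + (ctb * β))) * 2)) * cr)) * 2)) + ((1 * ((β + (β₁ + (ctb * β))) * 2)) * koo))) *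
          cr) + ((krD * (1 * ((β + (β₁ + (ctb * β))) * 2))) * cr)))) + (((2 * cι) * koW) * (((((cJ * ((c₂b * ((β + (β₁ + (ctb * β))) * 2)) + (2 * (c₁b * ((β + (β₁ + (ctb * β))) * 2))))) +
          θW) + ((cNb * ((β + (β₁ + (ctb * β))) * 2)) * cr)) + ((((LRb * R) * ((β + (β₁ + (ctb * β))) * 2)) * cr) + (((R * c₁b) * ((β + (β₁ + (ctb * β))) * 2)) * cr))) + ((θFb * (1 * ((β +
          (β₁ + (ctb * β))) * 2))) * cr))))) + (((cι2 * ((ε₀b * 2) + 0)) * koo) + ((cι2 * ((((ε₀b * ((R * ((((((km₀ + (koχ * β)) + (((km₁ + (koχ₁ * β₁)) + (ctb * km₀)) + (koχ₂ * β))) * cr) +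
          ((1 * (((km₀ + (koχ * β)) + (((km₁ + (koχ₁ * β₁)) + (ctb * km₀)) + (koχ₂ * β))) * cr)) * ((R * ((β + (β₁ + (ctb * β))) * 2)) * cr))) + (((((β + (β₁ + (ctb * β))) * ko) * cr) * ((β
          + (β₁ + (ctb * β))) * 2)) * cr)) * 2)) + (ko * ((β + (β₁ + (ctb * β))) * 2)))) * cr) * cr) + (krF * (1 + (((R * ((β + (β₁ + (ctb * β))) * 2)) * cr) * cr))))) + (((2 * cι) * koW) *
          ((ε₀b * 2) + 0))))))) * cr)) * cr)) * cr) + (((Nov * (((2 * (cι2 * ((β + (β₁ + (ctb * β))) * 2))) * koo) + ((cι2 * ((((((km₀ + (koχ * β)) + (((km₁ + (koχ₁ * β₁)) + (ctb * km₀)) +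
          (koχ₂ * β))) * cr) + ((1 * (((km₀ + (koχ * β)) + (((km₁ + (koχ₁ * β₁)) + (ctb * km₀)) + (koχ₂ * β))) * cr)) * ((R * ((β + (β₁ + (ctb * β))) * 2)) * cr))) + (((((β + (β₁ + (ctb *
          β))) * ko) * cr) * ((β + (β₁ + (ctb * β))) * 2)) * cr)) * 2)) + (((2 * cι) * koW) * ((β + (β₁ + (ctb * β))) * 2))))) * 2) * cr)) * S := by
  have m0 := cvkCmul (And.intro h0ct hbct) (And.intro h0β (le_refl β)); have m1 := cvkCadd (And.intro h0β₁ (le_refl β₁)) m0; have m2 := cvkCadd (And.intro h0β (le_refl β)) m1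
  have m3 := cvkCmul m2 (And.intro h0Iq hbIq); have m4 := cvkCmul (And.intro h0cι2 (le_refl cι2)) m3; have m5 := cvkCmul (And.intro h0Nov (le_refl Nov)) m4
  have m6 := cvkCmul (And.intro h0c₂ hbc₂) m3; have m7 := cvkCmul (And.intro h0c₁ hbc₁) m3; have m8 := cvkCmul (And.intro (zero_le_two : (0:ℝ) ≤ 2) (le_refl (2:ℝ))) m7
  have m9 := cvkCadd m6 m8; have m10 := cvkCmul (And.intro h0cJ (le_refl cJ)) m9; have m11 := cvkCadd m10 (And.intro h0θW (le_refl θW)); have m12 := cvkCmul (And.intro h0cN hbcN) m3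
  have m13 := cvkCmul m12 (And.intro h0cr (le_refl cr)); have m14 := cvkCadd m11 m13; have m15 := cvkCmul (And.intro h0LR hbLR) (And.intro h0R (le_refl R)); have m16 := cvkCmul m15 m3
  have m17 := cvkCmul m16 (And.intro h0cr (le_refl cr)); have m18 := cvkCmul (And.intro h0R (le_refl R)) (And.intro h0c₁ hbc₁); have m19 := cvkCmul m18 m3
  have m20 := cvkCmul m19 (And.intro h0cr (le_refl cr)); have m21 := cvkCadd m17 m20; have m22 := cvkCadd m14 m21
  have m23 := cvkCmul (And.intro (zero_le_one : (0:ℝ) ≤ 1) (le_refl (1:ℝ))) m3; have m24 := cvkCmul (And.intro h0θF hbθF) m23; have m25 := cvkCmul m24 (And.intro h0cr (le_refl cr))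
  have m26 := cvkCadd m22 m25; have m27 := cvkCmul (And.intro h0cι2 (le_refl cι2)) m26; have m28 := cvkCSmul m27 (And.intro h0oo hsoo)
  have m29 := cvkSCmul (And.intro h0oχ hsoχ) (And.intro h0β (le_refl β)); have m30 := cvkSadd (And.intro h0m₀ hsm₀) m29
  have m31 := cvkSCmul (And.intro h0oχ₁ hsoχ₁) (And.intro h0β₁ (le_refl β₁)); have m32 := cvkSadd (And.intro h0m₁ hsm₁) m31; have m33 := cvkCSmul (And.intro h0ct hbct) (And.intro h0m₀ hsm₀)
  have m34 := cvkSadd m32 m33; have m35 := cvkSCmul (And.intro h0oχ₂ hsoχ₂) (And.intro h0β (le_refl β)); have m36 := cvkSadd m34 m35; have m37 := cvkSadd m30 m36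
  have m38 := cvkSCmul m37 (And.intro h0cr (le_refl cr)); have m39 := cvkCSmul (And.intro (zero_le_one : (0:ℝ) ≤ 1) (le_refl (1:ℝ))) m38; have m40 := cvkCmul (And.intro h0R (le_refl R)) m3
  have m41 := cvkCmul m40 (And.intro h0cr (le_refl cr)); have m42 := cvkSCmul m39 m41; have m43 := cvkSadd m38 m42; have m44 := cvkCSmul m2 (And.intro h0o hso)
  have m45 := cvkSCmul m44 (And.intro h0cr (le_refl cr)); have m46 := cvkSCmul m45 m3; have m47 := cvkSCmul m46 (And.intro h0cr (le_refl cr)); have m48 := cvkSadd m43 m47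
  have m49 := cvkSCmul m48 (And.intro h0I1q hbI1q); have m50 := cvkCSmul (And.intro h0c₂ hbc₂) m49; have m51 := cvkSCmul (And.intro h0o₂ hso₂) m3; have m52 := cvkSadd m50 m51
  have m53 := cvkCSmul (And.intro h0c₁ hbc₁) m49; have m54 := cvkSCmul (And.intro h0o₁ hso₁) m3; have m55 := cvkSadd m53 m54
  have m56 := cvkCSmul (And.intro (zero_le_two : (0:ℝ) ≤ 2) (le_refl (2:ℝ))) m55; have m57 := cvkSadd m52 m56; have m58 := cvkCSmul (And.intro h0cJ (le_refl cJ)) m57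
  have m59 := cvkSadd m58 (And.intro h0rW hsrW); have m60 := cvkCSmul (And.intro h0cN hbcN) m49; have m61 := cvkSCmul m60 (And.intro h0cr (le_refl cr))
  have m62 := cvkSCmul (And.intro h0rN hsrN) m3; have m63 := cvkSCmul m62 (And.intro h0cr (le_refl cr)); have m64 := cvkSadd m61 m63; have m65 := cvkSadd m59 m64
  have m66 := cvkCSmul m15 m49
  have m67 := cvkCSmul (cvkCmul (And.intro (zero_le_two : (0:ℝ) ≤ 2) (le_refl (2:ℝ))) (And.intro h0R (le_refl R))) (cvkSadd (cvkSadd (And.intro h0oo hsoo) (And.intro h0Dη1 hsDη1)) (And.intro h0Dη0 hsDη0))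
  have m68 := cvkSadd (cvkCSmul (And.intro h0LR hbLR) (And.intro h0o hso)) m67; have m69 := cvkSCmul m68 m3; have m70 := cvkSadd m66 m69; have m71 := cvkCSmul (And.intro h0R (le_refl R)) m55
  have m72 := cvkSadd m70 m71; have m73 := cvkSCmul (cvkSCmul (And.intro h0o hso) (And.intro h0c₁ hbc₁)) m3; have m74 := cvkSadd m72 m73
  have m75 := cvkSCmul m74 (And.intro h0cr (le_refl cr)); have m76 := cvkSadd m65 m75; have m77 := cvkCSmul (And.intro (zero_le_one : (0:ℝ) ≤ 1) (le_refl (1:ℝ))) m49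
  have m78 := cvkCSmul m23 (And.intro h0oo hsoo); have m79 := cvkSadd m77 m78; have m80 := cvkCSmul (And.intro h0θF hbθF) m79; have m81 := cvkSCmul m80 (And.intro h0cr (le_refl cr))
  have m82 := cvkSCmul (And.intro h0rD hsrD) m23; have m83 := cvkSCmul m82 (And.intro h0cr (le_refl cr)); have m84 := cvkSadd m81 m83; have m85 := cvkSadd m76 m84
  have m86 := cvkCSmul (And.intro h0cι2 (le_refl cι2)) m85; have m87 := cvkCmul (And.intro (zero_le_two : (0:ℝ) ≤ 2) (le_refl (2:ℝ))) (And.intro h0cι (le_refl cι))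
  have m88 := cvkCSmul m87 (And.intro h0oW hsoW); have m89 := cvkSCmul m88 m26; have m90 := cvkSadd m86 m89; have m91 := cvkSadd m28 m90
  have m92 := cvkCmul (And.intro h0ε₀ hbε₀) (And.intro h0Iq hbIq); have m93 := cvkCadd m92 (And.intro (le_refl (0:ℝ)) (le_refl (0:ℝ)))
  have m94 := cvkCmul (And.intro h0cι2 (le_refl cι2)) m93; have m95 := cvkCSmul m94 (And.intro h0oo hsoo); have m96 := cvkCSmul (And.intro h0R (le_refl R)) m49
  have m97 := cvkSCmul (And.intro h0o hso) m3; have m98 := cvkSadd m96 m97; have m99 := cvkCSmul (And.intro h0ε₀ hbε₀) m98; have m100 := cvkSCmul m99 (And.intro h0cr (le_refl cr))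
  have m101 := cvkSCmul m100 (And.intro h0cr (le_refl cr)); have m102 := cvkCmul m41 (And.intro h0cr (le_refl cr))
  have m103 := cvkCadd (And.intro (zero_le_one : (0:ℝ) ≤ 1) (le_refl (1:ℝ))) m102; have m104 := cvkSCmul (And.intro h0rF hsrF) m103; have m105 := cvkSadd m101 m104
  have m106 := cvkSadd0 m105; have m107 := cvkCSmul (And.intro h0cι2 (le_refl cι2)) m106; have m108 := cvkSCmul m88 m93; have m109 := cvkSadd m107 m108; have m110 := cvkSadd m95 m109
  have m111 := cvkSadd m91 m110; have m112 := cvkCSmul (And.intro h0Nov (le_refl Nov)) m111; have m113 := cvkCSmul (And.intro h0IE hbIE) m112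
  have m114 := cvkSCmul m113 (And.intro h0cr (le_refl cr)); have m115 := cvkCSmul (And.intro h0IE hbIE) m114; have m116 := cvkSCmul m115 (And.intro h0cr (le_refl cr))
  have m117 := cvkCSmul m5 m116; have m118 := cvkSCmul m117 (And.intro h0cr (le_refl cr)); have m119 := cvkCmul (And.intro (zero_le_two : (0:ℝ) ≤ 2) (le_refl (2:ℝ))) m4
  have m120 := cvkCSmul m119 (And.intro h0oo hsoo); have m121 := cvkCSmul (And.intro h0cι2 (le_refl cι2)) m49; have m122 := cvkSCmul m88 m3; have m123 := cvkSadd m121 m122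
  have m124 := cvkSadd m120 m123; have m125 := cvkCSmul (And.intro h0Nov (le_refl Nov)) m124; have m126 := cvkSCmul m125 (And.intro h0IE hbIE)
  have m127 := cvkSCmul m126 (And.intro h0cr (le_refl cr)); have m128 := cvkSadd m118 m127
  exact m128

/-! ## §3 The glue factor of the cover is at most two -/

set_option maxHeartbeats 400000 in
/-- ★ **THE GLUE FACTOR `(1 − E)⁻¹ ≤ 2` AT THE COVER**: under FILE 119 `cvSmall`'s hypotheses its remainder letter `E` (displayed verbatim, cover letters) is `≤ ½` — the same four pieces
(`w⁻¹`-terms `≤ ¼`, far letter `≤ ¼`) — whence `0 ≤ (1 − E)⁻¹ ≤ 2`. [cite: Balaban1984PropagatorsII, (2.134)–(2.135) p.247 («O(M⁻¹)»: shape)] -/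
theorem cvSmallHalf {Nov cr cι2 cJ β β₁ w R θF ε₀ ε E' cN₀ D κ : ℝ} (hNov : 0 ≤ Nov) (hcr : 0 ≤ cr) (hcι : 0 ≤ cι2) (hcJ : 0 ≤ cJ) (hβ : 0 ≤ β) (hβ₁ : 0 ≤ β₁) (hw : 1 ≤ w)
    (hR : 0 ≤ R) (hθF : 0 ≤ θF) (hε : 0 < ε) (hE' : 0 ≤ E') (hcN₀ : 0 ≤ cN₀) (hD : 0 ≤ D) (hκ : 0 ≤ κ)
    (hq₀ : (β + (β₁ + π / w * β)) * (R * cr) * cr ≤ 1 / 2) (hθ : Nov * cr * (cι2 * (θF * (2 * (β + (β₁ + π * β))) * cr)) ≤ 1 / 4) (hε₀w : ε₀ ≤ κ / w)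
    (hW : 4 * (Nov * cr * (cι2 * ((cJ * (32 * π ^ 2 * (2 * (β + (β₁ + π * β))) + 2 * (π * (2 * (β + (β₁ + π * β))))) + (π * D * E' + 2 * (π * D)) * cN₀ * (2 * (β + (β₁ + π * β))) * cr) +
      ((π * D * (Real.exp 1 * ε)⁻¹ + 2 * (π * D + π * D * 1)) * R * (2 * (β + (β₁ + π * β))) * cr + R * π * (2 * (β + (β₁ + π * β))) * cr) + 2 * κ))) ≤ w) :
    0 ≤ (1 - (Nov * (cι2 * (((cJ * ((32 * π ^ 2 / w ^ 2) * ((β + (β₁ + (π / w) * β)) * (1 - (β + (β₁ + (π / w) * β)) * (R * cr) * cr)⁻¹) + 2 * ((π / w) * ((β + (β₁ + (π / w) * β)) * (1 - (β + (β₁ + (π / w) * β)) * (R * cr) * cr)⁻¹))) + (0:ℝ) + ((π * D / w * E' + 2 * (π * D / w)) * cN₀) * ((β + (β₁ + (π / w) * β)) * (1 - (β + (β₁ + (π / w) * β)) * (R * cr) * cr)⁻¹) * cr)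
          + (((π * D / w) * (Real.exp 1 * ε)⁻¹ + 2 * ((π * D / w) + (π * D / w) * (1:ℝ))) * R * ((β + (β₁ + (π / w) * β)) * (1 - (β + (β₁ + (π / w) * β)) * (R * cr) * cr)⁻¹) * cr + R * (π / w) * ((β + (β₁ + (π / w) * β)) * (1 - (β + (β₁ + (π / w) * β)) * (R * cr) * cr)⁻¹) * cr)) + (θF * (1 * ((β + (β₁ + (π / w) * β)) * (1 - (β + (β₁ + (π / w) * β)) * (R * cr) * cr)⁻¹)) * cr)) + cι2 * ((ε₀ * (1 - (β + (β₁ + (π / w) * β)) * (R * cr) * cr)⁻¹) + 0)) * cr))⁻¹ ∧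
      (1 - (Nov * (cι2 * (((cJ * ((32 * π ^ 2 / w ^ 2) * ((β + (β₁ + (π / w) * β)) * (1 - (β + (β₁ + (π / w) * β)) * (R * cr) * cr)⁻¹) + 2 * ((π / w) * ((β + (β₁ + (π / w) * β)) * (1 - (β + (β₁ + (π / w) * β)) * (R * cr) * cr)⁻¹))) + (0:ℝ) + ((π * D / w * E' + 2 * (π * D / w)) * cN₀) * ((β + (β₁ + (π / w) * β)) * (1 - (β + (β₁ + (π / w) * β)) * (R * cr) * cr)⁻¹) * cr)
          + (((π * D / w) * (Real.exp 1 * ε)⁻¹ + 2 * ((π * D / w) + (π * D / w) * (1:ℝ))) * R * ((β + (β₁ + (π / w) * β)) * (1 - (β + (β₁ + (π / w) * β)) * (R * cr) * cr)⁻¹) * cr + R * (π / w) * ((β + (β₁ + (π / w) * β)) * (1 - (β + (β₁ + (π / w) * β)) * (R * cr) * cr)⁻¹) * cr)) + (θF * (1 * ((β + (β₁ + (π / w) * β)) * (1 - (β + (β₁ + (π / w) * β)) * (R * cr) * cr)⁻¹)) * cr)) + cι2 * ((ε₀ * (1 - (β + (β₁ + (π / w) * β)) * (R * cr) * cr)⁻¹)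 + 0)) * cr))⁻¹ ≤ 2 := by
  have hw0 : 0 < w := by linarith
  -- the resummation factor `(1 − q₀)⁻¹ ≤ 2` and the cube letter `B ≤ B̄ = 2(β + β₁ + πβ)`
  set q₀ : ℝ := (β + (β₁ + (π / w) * β)) * (R * cr) * cr with hq₀def
  have hinv : (1 - q₀)⁻¹ ≤ 2 := by
    calc (1 - q₀)⁻¹ ≤ (1 / 2)⁻¹ := inv_anti₀ (by norm_num) (by linarith)
      _ = 2 := by norm_num
  have hinv0 : 0 ≤ (1 - q₀)⁻¹ := inv_nonneg.mpr (by linarith)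
  have hπw : π / w ≤ π := div_le_self pi_pos.le hw
  have hβs : β + (β₁ + (π / w) * β) ≤ β + (β₁ + π * β) := by
    have := mul_le_mul_of_nonneg_right hπw hβ
    linarith
  have hβs0 : 0 ≤ β + (β₁ + (π / w) * β) := by positivity
  set B : ℝ := (β + (β₁ + (π / w) * β)) * (1 - q₀)⁻¹ with hBdef
  set Bb : ℝ := 2 * (β + (β₁ + π * β)) with hBbdef
  have hB0 : 0 ≤ B := mul_nonneg hβs0 hinv0
  have hB : B ≤ Bb := by
    calc B ≤ (β + (β₁ + π * β)) * 2 := mul_le_mul hβs hinv hinv0 (by positivity)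
      _ = Bb := by rw [hBbdef]; ring
  have hBb0 : 0 ≤ Bb := by positivity
  -- the four pieces
  have hc₂ : 32 * π ^ 2 / w ^ 2 ≤ 32 * π ^ 2 / w := div_le_div_of_nonneg_left (by positivity) hw0 (by nlinarith)
  have hT1 : cJ * ((32 * π ^ 2 / w ^ 2) * B + 2 * ((π / w) * B)) + (0:ℝ) + ((π * D / w * E' + 2 * (π * D / w)) * cN₀) * B * cr ≤
      cJ * (32 * π ^ 2 / w * Bb + 2 * (π / w * Bb)) + 0 + ((π * D / w * E' + 2 * (π * D / w)) * cN₀) * Bb * cr := by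
    have h1 : 32 * π ^ 2 / w ^ 2 * B ≤ 32 * π ^ 2 / w * Bb := mul_le_mul hc₂ hB hB0 (by positivity)
    have h2 : π / w * B ≤ π / w * Bb := mul_le_mul_of_nonneg_left hB (by positivity)
    have h3 : ((π * D / w * E' + 2 * (π * D / w)) * cN₀) * B * cr ≤ ((π * D / w * E' + 2 * (π * D / w)) * cN₀) * Bb * cr :=
      mul_le_mul_of_nonneg_right (mul_le_mul_of_nonneg_left hB (by positivity)) hcr
    have h12 : cJ * ((32 * π ^ 2 / w ^ 2) * B + 2 * ((π / w) * B)) ≤ cJ * (32 * π ^ 2 / w * Bb + 2 * (π / w * Bb)) := mul_le_mul_of_nonneg_left (by linarith) hcJ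
    linarith
  have hT2 : ((π * D / w) * (Real.exp 1 * ε)⁻¹ + 2 * ((π * D / w) + (π * D / w) * (1:ℝ))) * R * B * cr + R * (π / w) * B * cr ≤
      ((π * D / w) * (Real.exp 1 * ε)⁻¹ + 2 * ((π * D / w) + (π * D / w) * (1:ℝ))) * R * Bb * cr + R * (π / w) * Bb * cr := by
    have hE0 : 0 ≤ (Real.exp 1 * ε)⁻¹ := by positivity
    have h1 : ((π * D / w) * (Real.exp 1 * ε)⁻¹ + 2 * ((π * D / w) + (π * D / w) * (1:ℝ))) * R * B * cr ≤ ((π * D / w) * (Real.exp 1 * ε)⁻¹ + 2 * ((π * D / w) + (π * D / w) * (1:ℝ))) * R * Bb * cr :=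
      mul_le_mul_of_nonneg_right (mul_le_mul_of_nonneg_left hB (by positivity)) hcr
    have h2 : R * (π / w) * B * cr ≤ R * (π / w) * Bb * cr := mul_le_mul_of_nonneg_right (mul_le_mul_of_nonneg_left hB (by positivity)) hcr
    linarith
  have hT3 : θF * (1 * B) * cr ≤ θF * (1 * Bb) * cr := mul_le_mul_of_nonneg_right (mul_le_mul_of_nonneg_left (by linarith) hθF) hcr
  have hT4 : ε₀ * (1 - q₀)⁻¹ + 0 ≤ 2 * κ / w := by
    have := mul_le_mul hε₀w hinv hinv0 (by positivity : 0 ≤ κ / w)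
    rw [add_zero]
    calc ε₀ * (1 - q₀)⁻¹ ≤ κ / w * 2 := this
      _ = 2 * κ / w := by ring
  -- the `w⁻¹` pieces as ONE fraction
  set A₁ : ℝ := cJ * (32 * π ^ 2 * Bb + 2 * (π * Bb)) + (π * D * E' + 2 * (π * D)) * cN₀ * Bb * cr with hA₁
  set A₂ : ℝ := (π * D * (Real.exp 1 * ε)⁻¹ + 2 * (π * D + π * D * 1)) * R * Bb * cr + R * π * Bb * cr with hA₂
  have eT1 : cJ * (32 * π ^ 2 / w * Bb + 2 * (π / w * Bb)) + 0 + ((π * D / w * E' + 2 * (π * D / w)) * cN₀) * Bb * cr = A₁ / w := by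
    rw [hA₁]; field_simp; ring
  have eT2 : ((π * D / w) * (Real.exp 1 * ε)⁻¹ + 2 * ((π * D / w) + (π * D / w) * (1:ℝ))) * R * Bb * cr + R * (π / w) * Bb * cr = A₂ / w := by
    rw [hA₂]; field_simp
  have hA₁0 : 0 ≤ A₁ := by positivity
  have hA₂0 : 0 ≤ A₂ := by positivity
  -- assemble
  have hsum : Nov * (cι2 * (((cJ * ((32 * π ^ 2 / w ^ 2) * B + 2 * ((π / w) * B)) + (0:ℝ) + ((π * D / w * E' + 2 * (π * D / w)) * cN₀) * B * cr)
          + (((π * D / w) * (Real.exp 1 * ε)⁻¹ + 2 * ((π * D / w) + (π * D / w) * (1:ℝ))) * R * B * cr + R * (π / w) * B * cr)) + (θF * (1 * B) * cr)) + cι2 * ((ε₀ * (1 - q₀)⁻¹) + 0)) * cr ≤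
      Nov * (cι2 * ((A₁ / w + A₂ / w) + θF * (1 * Bb) * cr) + cι2 * (2 * κ / w)) * cr := by
    have hin : ((cJ * ((32 * π ^ 2 / w ^ 2) * B + 2 * ((π / w) * B)) + (0:ℝ) + ((π * D / w * E' + 2 * (π * D / w)) * cN₀) * B * cr)
          + (((π * D / w) * (Real.exp 1 * ε)⁻¹ + 2 * ((π * D / w) + (π * D / w) * (1:ℝ))) * R * B * cr + R * (π / w) * B * cr)) ≤ A₁ / w + A₂ / w := by
      rw [← eT1, ← eT2]
      exact add_le_add hT1 hT2
    have hin3 : cι2 * (((cJ * ((32 * π ^ 2 / w ^ 2) * B + 2 * ((π / w) * B)) + (0:ℝ) + ((π * D / w * E' + 2 * (π * D / w)) * cN₀) * B * cr)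
          + (((π * D / w) * (Real.exp 1 * ε)⁻¹ + 2 * ((π * D / w) + (π * D / w) * (1:ℝ))) * R * B * cr + R * (π / w) * B * cr)) + (θF * (1 * B) * cr)) ≤ cι2 * ((A₁ / w + A₂ / w) + θF * (1 * Bb) * cr) := mul_le_mul_of_nonneg_left (add_le_add hin hT3) hcι
    have hin4 : cι2 * ((ε₀ * (1 - q₀)⁻¹) + 0) ≤ cι2 * (2 * κ / w) := mul_le_mul_of_nonneg_left hT4 hcι
    exact mul_le_mul_of_nonneg_right (mul_le_mul_of_nonneg_left (add_le_add hin3 hin4) hNov) hcr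
  have hfrac : Nov * (cι2 * (A₁ / w + A₂ / w) + cι2 * (2 * κ / w)) * cr ≤ 1 / 4 := by
    have e : Nov * (cι2 * (A₁ / w + A₂ / w) + cι2 * (2 * κ / w)) * cr = Nov * cr * (cι2 * (A₁ + A₂ + 2 * κ)) / w := by
      field_simp
    rw [e, div_le_iff₀ hw0]
    linarith
  have hfar : Nov * (cι2 * (θF * (1 * Bb) * cr)) * cr ≤ 1 / 4 := by
    have e : Nov * (cι2 * (θF * (1 * Bb) * cr)) * cr = Nov * cr * (cι2 * (θF * Bb * cr)) := by ring
    rw [e]; exact hθ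
  have esplit : Nov * (cι2 * ((A₁ / w + A₂ / w) + θF * (1 * Bb) * cr) + cι2 * (2 * κ / w)) * cr =
      Nov * (cι2 * (A₁ / w + A₂ / w) + cι2 * (2 * κ / w)) * cr + Nov * (cι2 * (θF * (1 * Bb) * cr)) * cr := by ring
  have hE := hsum.trans (show Nov * (cι2 * ((A₁ / w + A₂ / w) + θF * (1 * Bb) * cr) + cι2 * (2 * κ / w)) * cr ≤ 1 / 2 by linarith)
  have hE1 : (1 : ℝ) / 2 ≤ 1 - (Nov * (cι2 * (((cJ * ((32 * π ^ 2 / w ^ 2) * B + 2 * ((π / w) * B)) + (0:ℝ) + ((π * D / w * E' + 2 * (π * D / w)) * cN₀) * B * cr)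
          + (((π * D / w) * (Real.exp 1 * ε)⁻¹ + 2 * ((π * D / w) + (π * D / w) * (1:ℝ))) * R * B * cr + R * (π / w) * B * cr)) + (θF * (1 * B) * cr)) + cι2 * ((ε₀ * (1 - q₀)⁻¹) + 0)) * cr) := by linarith
  have hE0 : (0 : ℝ) ≤ 1 - (Nov * (cι2 * (((cJ * ((32 * π ^ 2 / w ^ 2) * B + 2 * ((π / w) * B)) + (0:ℝ) + ((π * D / w * E' + 2 * (π * D / w)) * cN₀) * B * cr)
          + (((π * D / w) * (Real.exp 1 * ε)⁻¹ + 2 * ((π * D / w) + (π * D / w) * (1:ℝ))) * R * B * cr + R * (π / w) * B * cr)) + (θF * (1 * B) * cr)) + cι2 * ((ε₀ * (1 - q₀)⁻¹) + 0)) * cr) := by linarith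
  exact ⟨inv_nonneg.mpr hE0, (inv_anti₀ (by norm_num) hE1).trans_eq (by norm_num)⟩

end Summit.QuantumFields.YangMills.BalabanUVNodes.N15.Gluing

end
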